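import Mathlib
import Summits.ResolutionOfSingularities.ResolutionOfSingularities.Theses.WeightedInvariant
import Literature.AlgebraicGeometry.Resolution.WeightedResolutionDatum
import Literature.AlgebraicGeometry.Resolution.CobordantBlowupGlobal
import Literature.AlgebraicGeometry.Resolution.QuasiProjectiveResolution
import Literature.AlgebraicGeometry.Resolution.Blowups
import Literature.AlgebraicGeometry.Resolution.BlowupsExistence
import Literature.AlgebraicGeometry.Resolution.BlowupsProperProofs
import Literature.AlgebraicGeometry.Resolution.BlowupsIntegral
import Literature.AlgebraicGeometry.Resolution.TameQuotientSingularitiesResolution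
import Summits.ResolutionOfSingularities.ResolutionOfSingularities.Theorems.WeightedInvariantDefs
import Summits.ResolutionOfSingularities.ResolutionOfSingularities.Theorems.WeightedInvariantDatumToEmbeddedRegular
import Summits.ResolutionOfSingularities.ResolutionOfSingularities.Theorems.WeightedInvariantWeightedThesisGlobalCobordantPlus
import Summits.ResolutionOfSingularities.ResolutionOfSingularities.Theorems.WeightedInvariantDatumToEmbeddedInitialAtlas
import Summits.ResolutionOfSingularities.ResolutionOfSingularities.Theorems.WeightedInvariantDatumToEmbeddedCentreHomogeneous
import Summits.ResolutionOfSingularities.ResolutionOfSingularities.Theorems.WeightedInvariantDatumToEmbeddedStrictTransform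
import Summits.ResolutionOfSingularities.ResolutionOfSingularities.Theorems.WeightedInvariantDatumToEmbeddedInvDrop
import Summits.ResolutionOfSingularities.ResolutionOfSingularities.Theorems.WeightedInvariantDatumToEmbeddedExceptional
import Summits.ResolutionOfSingularities.ResolutionOfSingularities.Theorems.WeightedInvariantDatumToEmbeddedDegree
import Summits.ResolutionOfSingularities.ResolutionOfSingularities.Theorems.WeightedInvariantDatumToEmbeddedLift
import Summits.ResolutionOfSingularities.ResolutionOfSingularities.Theorems.WeightedInvariantDatumToEmbeddedAtlasSucc
import Summits.ResolutionOfSingularities.ResolutionOfSingularities.Theorems.WeightedInvariantDatumToEmbeddedQuotientSingularitiesSliceCore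
import Summits.ResolutionOfSingularities.ResolutionOfSingularities.Theorems.WeightedInvariantDatumToEmbeddedQuotientBase
import HarnessLib

/-!
# Crux `DatumToEmbedded` (stmt-ResolutionOfSingularities-0572), line `Sketch`: datum ⇒ embedded resolution, modulo Bergh–Rydh

Topic: `Summits/ResolutionOfSingularities/ResolutionOfSingularities/Theorems`. Route
`ResolutionOfSingularities/WeightedInvariant`, crux `Theses.WeightedInvariant.DatumToEmbedded`:
a weighted resolution datum in characteristic `p` (`WeightedResolutionDatum p`, Włodarczyk
arXiv:2203.03090 / Abramovich–Temkin–Włodarczyk 2024, interface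
`Literature/…/WeightedResolutionDatum.lean`) yields a resolution of every integral closed subscheme
`X` of a smooth separated quasi-compact `Y` over a perfect field of characteristic `p`.

`datumToEmbedded_of_berghRydh2019 : BerghRydh2019_diagonalizableQuotientResolution → DatumToEmbedded`
proves the crux MODULO one named published fact (Bergh–Rydh, arXiv:1905.00872, Thm 5, in its
étale-local diagonalizable special case, `Literature/…/TameQuotientSingularitiesResolution.lean`),
by the landed induction engine `WeightedResolutionDatum.maxinv_induction` (well-founded induction
on `max inv`) over the predicate (`hasResolution_quotient_of_gradedAtlas`)

  "for every closed immersion `i : X ⟶ Y` with `i.ker = I`, `X` integral, and every TORUS-QUOTIENT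
  PRESENTATION `q : X ⟶ V` of rank `j` (`GradedAtlas j f i q`, `Theorems/WeightedInvariantDefs.lean`:
  affine charts `W_a ⊆ Y`, `U_a ⊆ V` with `X ∩ W_a = q⁻¹ U_a`, `ℤʲ`-gradings of `Γ(Y, W_a)` for
  which the ideal of `X` is homogeneous, `Γ(V, U_a)` = the degree-`0` sections of `X` over the chart,
  homogeneous units of every degree in `e·ℤʲ` near every point — Włodarczyk §2.3.1, the graded
  encoding of a good geometric quotient by `𝔾ₘʲ`), the scheme `V` has a resolution":

* base (`inv ≡ ⊥`, `X` regular): `V` is étale-locally `Spec S₀` for a smooth finite-type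
  `k`-algebra `S` graded by a finite abelian group (Luna slice: `QuotientSingularities.stub_qs_sliceCore`
  + `QuotientBase.stub_qs_base`), so the named fact gives `HasResolution V`;
* step (guard on): the datum's centre is a regular weighted centre supported on the maximum locus;
  `R' :=` its Rees filtration; `Y' := B₊ = R'.plus` (the GLOBAL cobordant
  blow-up, `CobordantBlowupGlobal`) is smooth separated quasi-compact over `k`
  (`GlobalCobordantPlus.stub_smooth_globalCobordantPlus`); the strict transform
  `X' = V(R'.strictTransformPlus i.ker)` is integral and lies over `X`
  (`StrictTransform.stub_strictTransform`); `max inv` drops (`InvDrop.stub_inv_drop`); the centre is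
  homogeneous on the graded charts (`CentreHomogeneous.stub_centre_isHomogeneous`); and THE QUOTIENT
  OF THE COBORDANT BLOW-UP IS A BLOW-UP DOWNSTAIRS (`quotientStep`): for a Veronese degree `Dg`
  (`Exceptional.stub_qs_exceptional`, `Degree.stub_qs_degree_explicit`) and
  `K := ker (V(J_Dg|_X) ⟶ V)`, every blow-up `ρ : V' ⟶ V` along `K ≠ ⊥` receives `q' : X' ⟶ V'`
  (`Lift.stub_qs_lift`) carrying a `GradedAtlas (j+1)` (`Atlas.gradedAtlas_succ`); `ρ` is proper
  and birational with `V'` integral (tree blow-up theory), the induction hypothesis resolves `V'`,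
  and `HasResolution.of_isBirational ρ` resolves `V`;
* start: `q = 𝟙 X`, rank `0` (`InitialAtlas.stub_initialAtlas`).

This file is sorry-free: the crux is proved CONDITIONALLY on the named fact (taken as the hypothesis
`hBR`); the crux workfile `Cruxes/DatumToEmbedded/Lines/Sketch.lean` carries the same proof with the
fact as its one remaining registered stub `stub_berghRydh2019`.
-/

noncomputable section

open CategoryTheory CategoryTheory.Limits AlgebraicGeometry TopologicalSpace
open Literature.AlgebraicGeometry.Resolution
open Summit.ResolutionOfSingularities.ResolutionOfSingularities.Theses.WeightedInvariant
open Summit.ResolutionOfSingularities.ResolutionOfSingularities.Theorems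

set_option linter.dupNamespace false -- mandated namespace of this single-conjunct summit

namespace Summit.ResolutionOfSingularities.ResolutionOfSingularities.Theorems

namespace DatumToEmbedded

/-! ## The quotient step -/

/-- **The quotient of the cobordant blow-up is a blow-up downstairs**: there is an ideal sheaf
`K ≠ ⊥` on `V` such that for every blow-up `ρ : V' ⟶ V` along `K` the strict transform maps to
`V'` over `X ⟶ V` with a graded atlas of rank `j + 1` (Veronese degree from
`Exceptional.stub_qs_exceptional` and `Degree.stub_qs_degree_explicit`, the lift from
`Lift.stub_qs_lift`, the atlas from `Atlas.gradedAtlas_succ`).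
[cite: Wlodarczyk2022, §2.3.3 and Thm 1.1.4 (5)] -/
theorem quotientStep
    {p : ℕ} (D : WeightedResolutionDatum p) {k : Type} [Field k] [CharP k p] [PerfectField k]
    {Y X V : Scheme.{0}} (f : Y ⟶ Spec (.of k)) [Smooth f] [IsSeparated f] [QuasiCompact f]
    (i : X ⟶ Y) [IsClosedImmersion i] [IsIntegral X] (q : X ⟶ V) [IsIntegral V]
    (g : V ⟶ Spec (.of k)) [IsSeparated g] [LocallyOfFiniteType g] [QuasiCompact g]
    (hq : q ≫ g = i ≫ f) {j : ℕ} (𝒜 : GradedAtlas j f i q)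
    (hguard : ∃ y : Y, ¬ IsBot (D.inv f i.ker y))
    (hhom : ∀ (a : 𝒜.ι) (n : ℕ), @Ideal.IsHomogeneous (Fin j → ℤ) (AddSubgroup Γ(Y, 𝒜.W a))
      Γ(Y, 𝒜.W a) _ _ _ (𝒜.piece a) _ _ (𝒜.gradedRing a)
      (((D.centre f i.ker).piece n).ideal (𝒜.W a)))
    (R' : ReesFiltration Y) (hR' : R'.ideal = (D.centre f i.ker).piece)
    [Smooth (R'.πPlus ≫ f)] [IsSeparated (R'.πPlus ≫ f)] [QuasiCompact (R'.πPlus ≫ f)]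
    [IsIntegral (R'.strictTransformPlus i.ker).subscheme]
    (σX : (R'.strictTransformPlus i.ker).subscheme ⟶ X)
    (hσX : σX ≫ i = (R'.strictTransformPlus i.ker).subschemeι ≫ R'.πPlus) :
    ∃ K : V.IdealSheafData, K ≠ ⊥ ∧ ∀ (V' : Scheme.{0}) (ρ : V' ⟶ V), IsBlowup ρ K →
      ∀ [IsIntegral V'], ∃ q' : (R'.strictTransformPlus i.ker).subscheme ⟶ V',
        q' ≫ ρ = σX ≫ q ∧
        Nonempty (GradedAtlas (j + 1) (R'.πPlus ≫ f)
          (R'.strictTransformPlus i.ker).subschemeι q') := by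
  obtain ⟨N₀, hN₀, hexc⟩ := Exceptional.stub_qs_exceptional D f i.ker hguard R' hR'
  obtain ⟨Dg, hDg, hdvd, hA2, hA3⟩ :=
    Degree.stub_qs_degree_explicit D f i q g hq 𝒜 hguard hhom R' hR' σX hσX N₀ hN₀ hexc
  -- `q` is quasi-compact: it is affine on the charts of the atlas (needed for `Hom.ker`)
  haveI : QuasiCompact q := by
    haveI : QuasiCompact (q ≫ g) := by rw [hq]; infer_instance
    exact .of_comp q g
  obtain ⟨hK, hlift⟩ := Lift.stub_qs_lift D f i q hguard R' hR' σX hσX Dg hDg hA3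
  refine ⟨_, hK, fun V' ρ hρ _ => ?_⟩
  obtain ⟨q', hq'⟩ := hlift V' ρ hρ
  exact ⟨q', hq', Atlas.gradedAtlas_succ D f i q g hq 𝒜 hguard hhom R' hR' σX hσX Dg hDg
    (hexc Dg hdvd) hA2 hA3 V' ρ hρ q' hq'⟩

/-! ## The base case -/

/-- **The base case**: if `X` is regular, a torus quotient `V` presented by a graded atlas has
finite diagonalizable quotient singularities étale-locally, in the sense of
`BerghRydh2019_diagonalizableQuotientResolution` (`QuotientBase.stub_qs_base` applied to the
slice core `QuotientSingularities.stub_qs_sliceCore`). [folklore; the Zariski form of Luna's slice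
for diagonalizable groups, cf. Abramovich–Temkin arXiv:1505.00754 §5.1] -/
theorem quotientSingularities_of_regular
    {k : Type} [Field k] [PerfectField k] {Y X V : Scheme.{0}} (f : Y ⟶ Spec (.of k))
    [Smooth f] [IsSeparated f] [QuasiCompact f] (i : X ⟶ Y) [IsClosedImmersion i]
    (q : X ⟶ V) [IsIntegral V] (g : V ⟶ Spec (.of k)) [IsSeparated g] [LocallyOfFiniteType g]
    [QuasiCompact g] (hq : q ≫ g = i ≫ f) (hreg : Scheme.IsRegular X)
    {j : ℕ} (𝒜 : GradedAtlas j f i q) :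
    ∀ v : V, ∃ (A : Type) (_ : AddCommGroup A) (_ : Finite A) (_ : DecidableEq A)
        (S : Type) (_ : CommRing S) (_ : Algebra k S) (𝒮 : A → Submodule k S)
        (_ : GradedAlgebra 𝒮), Algebra.FiniteType k S ∧ Algebra.Smooth k S ∧
        ∃ φ : Spec (.of (𝒮 0)) ⟶ V, Etale φ ∧ v ∈ Set.range φ ∧
          φ ≫ g = Spec.map (CommRingCat.ofHom (algebraMap k (𝒮 0))) :=
  QuotientBase.stub_qs_base QuotientSingularities.stub_qs_sliceCore f i q g hq hreg 𝒜

/-! ## The induction -/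

/-- **Every torus-quotient presentation of an integral closed subscheme of `Y` has a resolved
quotient**, granted the named fact: well-founded induction on `max inv`
(`WeightedResolutionDatum.maxinv_induction`) with base `quotientSingularities_of_regular` + the
fact and step = global cobordant blow-up + `quotientStep` + `HasResolution.of_isBirational` along
the blow-up downstairs. [cite: Wlodarczyk2022, Thm 1.1.4 (5), Thm 1.1.6; BerghRydh2019, Thm 5] -/
theorem hasResolution_quotient_of_gradedAtlas
    (hBR : BerghRydh2019_diagonalizableQuotientResolution)
    {p : ℕ} (D : WeightedResolutionDatum p) {k : Type} [Field k] [CharP k p] [PerfectField k]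
    (Y : Scheme.{0}) (f : Y ⟶ Spec (.of k)) [Smooth f] [IsSeparated f] [QuasiCompact f]
    (I : Y.IdealSheafData) :
    ∀ (X V : Scheme.{0}) (i : X ⟶ Y) [IsClosedImmersion i] [IsIntegral X], i.ker = I →
      ∀ (g : V ⟶ Spec (.of k)) [IsSeparated g] [LocallyOfFiniteType g] [QuasiCompact g]
        [IsIntegral V] (q : X ⟶ V), q ≫ g = i ≫ f → ∀ (j : ℕ), GradedAtlas j f i q →
        Scheme.HasResolution V := by
  have key := WeightedResolutionDatum.maxinv_induction D
    (fun (Y : Scheme.{0}) (f : Y ⟶ Spec (.of k)) (I : Y.IdealSheafData) =>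
      ∀ [Smooth f] [IsSeparated f] [QuasiCompact f] (X V : Scheme.{0}) (i : X ⟶ Y)
        [IsClosedImmersion i] [IsIntegral X], i.ker = I →
        ∀ (g : V ⟶ Spec (.of k)) [IsSeparated g] [LocallyOfFiniteType g] [QuasiCompact g]
          [IsIntegral V] (q : X ⟶ V), q ≫ g = i ≫ f → ∀ (j : ℕ), GradedAtlas j f i q →
          Scheme.HasResolution V) ?base ?step Y f I
  · exact fun X V i _ _ hI g _ _ _ _ q hq j 𝒜 => key X V i hI g q hq j 𝒜
  · -- base: `inv` everywhere minimal ⇒ `X` regular ⇒ quotient singularities ⇒ named fact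
    intro Y f _ _ _ I hbot _ _ _ X V i _ _ hI g _ _ _ _ q hq j 𝒜
    subst hI
    have hreg : Scheme.IsRegular X := (isRegular_iff_forall_isBot_inv D f i).mpr hbot
    exact hBR k V g (quotientSingularities_of_regular f i q g hq hreg 𝒜)
  · -- step
    intro Y f _ _ _ I y₀ hy₀ hmax ih _ _ _ X V i _ _ hI g _ _ _ _ q hq j 𝒜
    subst hI
    have hguard : ∃ y : Y, ¬ IsBot (D.inv f i.ker y) := ⟨y₀, hy₀⟩
    -- the Rees filtration of the datum's centre (its pieces decrease: under the guard the centre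
    -- is a regular weighted centre, `antitone_piece`)
    let R' : ReesFiltration Y :=
      { ideal := (D.centre f i.ker).piece
        ideal_zero := (D.centre f i.ker).piece_zero
        antitone := antitone_piece (D.isRegularWeightedCentre_centre f i.ker hguard)
        mul_le := (D.centre f i.ker).piece_mul_le }
    -- the new ambient is smooth separated quasi-compact
    obtain ⟨hsm', hsep', hqc'⟩ :=
      WeightedThesis.GlobalCobordantPlus.stub_smooth_globalCobordantPlus D f i.ker hguard R' rfl
    haveI := hsm'; haveI := hsep'; haveI := hqc'
    -- the strict transform is integral and lies over `X`
    obtain ⟨hint', hker⟩ := StrictTransform.stub_strictTransform D f i hguard R' rfl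
    haveI := hint'
    set I' := R'.strictTransformPlus i.ker with hI'
    let i' := I'.subschemeι
    let σX : I'.subscheme ⟶ X := IsClosedImmersion.lift i (i' ≫ R'.πPlus) hker
    have hσX : σX ≫ i = i' ≫ R'.πPlus := IsClosedImmersion.lift_fac _ _ _
    -- homogeneity of the centre on the charts, then the quotient step
    have hhom := fun (a : 𝒜.ι) (n : ℕ) =>
      @CentreHomogeneous.stub_centre_isHomogeneous p D k _ _ _ Y f _ _ _ i.ker hguard j (𝒜.W a)
        (𝒜.piece a) (𝒜.gradedRing a) (𝒜.appLE_mem a) (𝒜.isHomogeneous_ker a) n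
    obtain ⟨K, hK, hstep⟩ := quotientStep D f i q g hq 𝒜 hguard hhom R' rfl σX hσX
    -- blow `V` up along `K`
    obtain ⟨V', ρ, hρ⟩ := exists_isBlowup V K
    haveI : IsLocallyNoetherian V := LocallyOfFiniteType.isLocallyNoetherian g
    haveI : IsProper ρ := hρ.isProper
    have hbir : IsBirational ρ := hρ.isBirational' hK
    haveI : IsIntegral V' := hρ.isIntegral hK
    obtain ⟨q', hq', ⟨𝒜'⟩⟩ := hstep V' ρ hρ
    -- the induction hypothesis resolves `V'`
    have hdrop := InvDrop.stub_inv_drop D f i.ker hguard y₀ hmax R' rfl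
    have hV' : Scheme.HasResolution V' := by
      have hQ' := ih (R'.plus : Scheme.{0}) (R'.πPlus ≫ f) I' hdrop
      refine hQ' I'.subscheme V' i' (Scheme.IdealSheafData.ker_subschemeι I') (ρ ≫ g) q' ?_
        (j + 1) 𝒜'
      rw [← Category.assoc, hq', Category.assoc, hq, ← Category.assoc, hσX, Category.assoc]
    exact Scheme.HasResolution.of_isBirational ρ hbir hV'

end DatumToEmbedded

/-! ## The crux, modulo the named fact -/

/-- **Datum ⇒ embedded resolution, modulo Bergh–Rydh** (crux `Theses.WeightedInvariant.DatumToEmbedded`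
granted the named fact `BerghRydh2019_diagonalizableQuotientResolution`, sorry-free): run
`DatumToEmbedded.hasResolution_quotient_of_gradedAtlas` on the trivial presentation `q = 𝟙 X` of
rank `0` (`InitialAtlas.stub_initialAtlas`). [cite: Wlodarczyk2022, Thm 1.1.6; BerghRydh2019, Thm 5] -/
theorem datumToEmbedded_of_berghRydh2019
    (hBR : BerghRydh2019_diagonalizableQuotientResolution) : DatumToEmbedded := by
  intro p hp hD k _ _ _ Y X f i hf hsep hqc hi hint
  obtain ⟨D⟩ := hD
  haveI := hf; haveI := hsep; haveI := hqc; haveI := hi; haveI := hint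
  obtain ⟨𝒜₀⟩ := DatumToEmbedded.InitialAtlas.stub_initialAtlas f i
  haveI : IsSeparated (i ≫ f) := inferInstance
  haveI : LocallyOfFiniteType (i ≫ f) := inferInstance
  haveI : QuasiCompact (i ≫ f) := inferInstance
  exact DatumToEmbedded.hasResolution_quotient_of_gradedAtlas hBR D Y f i.ker X X i rfl (i ≫ f)
    (𝟙 X) (Category.id_comp _) 0 𝒜₀

end Summit.ResolutionOfSingularities.ResolutionOfSingularities.Theorems

end
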